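import Mathlib.Analysis.SpecialFunctions.Gaussian.FourierTransform
import Mathlib.Analysis.Fourier.RiemannLebesgueLemma
import Mathlib.Analysis.SpecialFunctions.Trigonometric.Bounds
import Mathlib.MeasureTheory.Integral.IntegralEqImproper
import Mathlib.MeasureTheory.Integral.Prod
import Mathlib.MeasureTheory.Measure.Lebesgue.Integral
import HarnessLib

/-!
# Dirichlet's integral: `∫₀^∞ φ(u) sin(Tu)/u du → (π/2) φ(0)` as `T → ∞`

`Literature/Analysis/Fourier`. The classical Dirichlet-integral limit (Dirichlet 1829; Titchmarsh,
*Introduction to the Theory of Fourier Integrals*, §1.9; Zygmund, *Trigonometric Series* II §1) in the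
form needed for Fourier sine integrals on a half-line: if `φ : ℝ → ℝ` is continuous, integrable on
`(0, ∞)` and satisfies the Lipschitz-type condition `|φ(u) − φ(0)| ≤ C u` on `(0, 1]`, then

  `∫₀^∞ φ(u) (sin(Tu)/u) du → (π/2) φ(0)`  as `T → +∞`

(`tendsto_integral_Ioi_mul_sin_div`). The proof avoids the improper integral `∫₀^∞ sin u / u du`
(not in Mathlib): the Gaussian model `φ₀(u) = e^{−u²/2}` is treated exactly
(`∫₀^∞ e^{−u²/2} sin(Tu)/u du = (√(2π)/2) ∫₀^T e^{−y²/2} dy → π/2`, from Mathlib's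
`fourierIntegral_gaussian` and Fubini), and the remainder `(φ − φ(0)φ₀)/u`, integrable on `(0,∞)`,
is killed by the Riemann–Lebesgue lemma (Mathlib `Real.tendsto_integral_exp_smul_cocompact`).
Also recorded, since they are the two halves of the argument:

* `intervalIntegral_integral_Ioi_mul_cos` (Fubini): `∫₀^T (∫₀^∞ φ(u) cos(yu) du) dy = ∫₀^∞ φ(u) sin(Tu)/u du`;
* `tendsto_integral_Ioi_mul_sin_atTop` (Riemann–Lebesgue, sine form): `∫₀^∞ h(u) sin(Tu) du → 0`.

Mathlib has the Riemann–Lebesgue lemma, Fourier inversion and the Gaussian Fourier transform, but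
neither `∫ sin x / x` nor a Dirichlet–Jordan type theorem (searched `sinc`, `Dirichlet`, `sin_div`).
Everything here is proved; no definitions, no named facts.

## References

* E. C. Titchmarsh, *Introduction to the Theory of Fourier Integrals*, 2nd ed., Oxford 1948, §1.9
  (Dirichlet's integral; Fourier's single-integral formula).
* A. Zygmund, *Trigonometric Series*, 2nd ed., Vol. I, Ch. II §1 (Dirichlet's integral `∫₀^∞ sin x/x = π/2`).
-/

noncomputable section

open Filter Topology Set MeasureTheory Complex
open scoped Real

namespace Literature.Analysis.Fourier

/-! ## Bounded trigonometric factors -/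

/-- `u ↦ f(u) cos(yu)` is integrable when `f` is. [folklore] -/
theorem integrable_mul_cos {f : ℝ → ℝ} {μ : Measure ℝ} (hf : Integrable f μ) (y : ℝ) :
    Integrable (fun u => f u * Real.cos (y * u)) μ :=
  Integrable.mul_bdd hf (Continuous.aestronglyMeasurable (by fun_prop))
    (Eventually.of_forall fun u => by
      rw [Real.norm_eq_abs]; exact Real.abs_cos_le_one _)

/-- `u ↦ f(u) sin(yu)` is integrable when `f` is. [folklore] -/
theorem integrable_mul_sin {f : ℝ → ℝ} {μ : Measure ℝ} (hf : Integrable f μ) (y : ℝ) :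
    Integrable (fun u => f u * Real.sin (y * u)) μ :=
  Integrable.mul_bdd hf (Continuous.aestronglyMeasurable (by fun_prop))
    (Eventually.of_forall fun u => by
      rw [Real.norm_eq_abs]; exact Real.abs_sin_le_one _)

/-- `|sin(Tu)/u| ≤ |T|` (with `sin 0 / 0 = 0`). [folklore] -/
theorem norm_sin_mul_div_le (T u : ℝ) : ‖Real.sin (T * u) / u‖ ≤ |T| := by
  rw [Real.norm_eq_abs]
  rcases eq_or_ne u 0 with rfl | hu
  · simp
  · rw [abs_div, div_le_iff₀ (abs_pos.mpr hu), ← abs_mul]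
    exact Real.abs_sin_le_abs

/-- `u ↦ f(u) · sin(Tu)/u` is integrable when `f` is. [folklore] -/
theorem integrable_mul_sin_div {f : ℝ → ℝ} {μ : Measure ℝ} (hf : Integrable f μ) (T : ℝ) :
    Integrable (fun u => f u * (Real.sin (T * u) / u)) μ :=
  Integrable.mul_bdd hf
    ((by fun_prop : Measurable fun u : ℝ => Real.sin (T * u) / u).aestronglyMeasurable)
    (Eventually.of_forall (norm_sin_mul_div_le T))

/-! ## Fubini: integrating the cosine transform in the frequency -/

/-- **Fubini step**: for `φ` continuous and integrable on `(0, ∞)` and `T ≥ 0`,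
`∫₀^T (∫₀^∞ φ(u) cos(yu) du) dy = ∫₀^∞ φ(u) (sin(Tu)/u) du` (Titchmarsh, *Fourier Integrals* §1.9).
[folklore] -/
theorem intervalIntegral_integral_Ioi_mul_cos {φ : ℝ → ℝ} (hφc : Continuous φ)
    (hφ : IntegrableOn φ (Ioi 0)) {T : ℝ} (hT : 0 ≤ T) :
    ∫ y in (0 : ℝ)..T, (∫ u in Ioi (0 : ℝ), φ u * Real.cos (y * u)) =
      ∫ u in Ioi (0 : ℝ), φ u * (Real.sin (T * u) / u) := by
  rw [intervalIntegral.integral_of_le hT]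
  have hint : Integrable (Function.uncurry fun (y u : ℝ) => φ u * Real.cos (y * u))
      ((volume.restrict (Ioc 0 T)).prod (volume.restrict (Ioi 0))) := by
    refine Integrable.mono' ((integrable_const (1 : ℝ)).mul_prod hφ.norm) ?_ ?_
    · exact Continuous.aestronglyMeasurable (by fun_prop)
    · filter_upwards with p
      simp only [Function.uncurry, norm_mul, Real.norm_eq_abs, one_mul]
      exact mul_le_of_le_one_right (abs_nonneg _) (Real.abs_cos_le_one _)
  rw [integral_integral_swap hint]
  refine setIntegral_congr_fun measurableSet_Ioi fun u hu => ?_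
  have hu' : u ≠ 0 := ne_of_gt hu
  rw [integral_const_mul, ← intervalIntegral.integral_of_le hT]
  congr 1
  rw [intervalIntegral.integral_comp_mul_right (fun x => Real.cos x) hu', integral_cos]
  simp only [zero_mul, Real.sin_zero, sub_zero, smul_eq_mul]
  field_simp

/-! ## Riemann–Lebesgue for the sine transform on the half-line -/

/-- **Riemann–Lebesgue lemma, sine form**: for `h` integrable on `(0, ∞)`,
`∫₀^∞ h(u) sin(Tu) du → 0` as `T → +∞` (from Mathlib's `Real.tendsto_integral_exp_smul_cocompact`
applied to `h·𝟙_{(0,∞)}`, taking imaginary parts). [folklore] -/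
theorem tendsto_integral_Ioi_mul_sin_atTop {h : ℝ → ℝ} (hh : IntegrableOn h (Ioi 0)) :
    Tendsto (fun T : ℝ => ∫ u in Ioi (0 : ℝ), h u * Real.sin (T * u)) atTop (𝓝 0) := by
  set f : ℝ → ℂ := (Ioi (0 : ℝ)).indicator (fun u => (h u : ℂ)) with hf
  have hRL := Real.tendsto_integral_exp_smul_cocompact f
  have hT : Tendsto (fun T : ℝ => -T / (2 * π)) atTop (cocompact ℝ) :=
    (tendsto_neg_atTop_atBot.atBot_div_const (by positivity)).mono_right atBot_le_cocompact
  have h2 := hRL.comp hT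
  have h3 : ∀ T : ℝ, (∫ v, Real.fourierChar (-(v * (-T / (2 * π)))) • f v) =
      ∫ u in Ioi (0 : ℝ), Complex.exp (↑(T * u) * I) * (h u : ℂ) := by
    intro T
    rw [← integral_indicator measurableSet_Ioi]
    congr 1; ext v
    rw [hf]
    by_cases hv : v ∈ Ioi (0 : ℝ)
    · rw [indicator_of_mem hv, indicator_of_mem hv, Circle.smul_def, Real.fourierChar_apply,
        smul_eq_mul]
      congr 2
      push_cast
      field_simp
    · rw [indicator_of_notMem hv, indicator_of_notMem hv, smul_zero]
  have h4 : Tendsto (fun T : ℝ => ∫ u in Ioi (0 : ℝ), Complex.exp (↑(T * u) * I) * (h u : ℂ))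
      atTop (𝓝 0) := h2.congr h3
  have h5 := (Complex.continuous_im.tendsto 0).comp h4
  simp only [Complex.zero_im] at h5
  refine h5.congr fun T => ?_
  have hint : Integrable (fun u => Complex.exp (↑(T * u) * I) * (h u : ℂ)) (volume.restrict (Ioi 0)) :=
    Integrable.bdd_mul hh.ofReal (Continuous.aestronglyMeasurable (by fun_prop))
      (Eventually.of_forall fun u => by rw [Complex.norm_exp_ofReal_mul_I])
  have := integral_im hint
  simp only [RCLike.im_to_complex, Function.comp] at this ⊢
  rw [← this]
  congr 1; ext u
  rw [Complex.im_mul_ofReal, Complex.exp_ofReal_mul_I_im]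
  ring

/-! ## The Gaussian model -/

/-- `∫₀^∞ e^{−u²/2} cos(yu) du = (√(2π)/2) e^{−y²/2}` (real part of Mathlib's
`fourierIntegral_gaussian`, halved by evenness). [folklore] -/
theorem integral_Ioi_gaussian_mul_cos (y : ℝ) :
    ∫ u in Ioi (0 : ℝ), Real.exp (-(1 / 2) * u ^ 2) * Real.cos (y * u) =
      Real.sqrt (2 * π) / 2 * Real.exp (-(1 / 2) * y ^ 2) := by
  have hF := fourierIntegral_gaussian (b := (1 / 2 : ℂ)) (by norm_num) (y : ℂ)
  have hpt : ∀ x : ℝ, Complex.exp (I * y * x) * Complex.exp (-(1 / 2 : ℂ) * (x : ℂ) ^ 2) =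
      ((Real.exp (-(1 / 2) * x ^ 2) * Real.cos (y * x) : ℝ) : ℂ) +
        ((Real.exp (-(1 / 2) * x ^ 2) * Real.sin (y * x) : ℝ) : ℂ) * I := by
    intro x
    rw [show I * (y : ℂ) * x = ((y * x : ℝ) : ℂ) * I by push_cast; ring, Complex.exp_mul_I]
    have : Complex.exp (-(1 / 2 : ℂ) * (x : ℂ) ^ 2) = ((Real.exp (-(1 / 2) * x ^ 2) : ℝ) : ℂ) := by
      push_cast; ring_nf
    rw [this]
    push_cast
    ring
  simp_rw [hpt] at hF
  have hg : Integrable (fun x : ℝ => Real.exp (-(1 / 2) * x ^ 2)) := integrable_exp_neg_mul_sq one_half_pos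
  have hi1 : Integrable (fun x : ℝ => ((Real.exp (-(1 / 2) * x ^ 2) * Real.cos (y * x) : ℝ) : ℂ)) :=
    (integrable_mul_cos hg y).ofReal
  have hi2 : Integrable (fun x : ℝ =>
      ((Real.exp (-(1 / 2) * x ^ 2) * Real.sin (y * x) : ℝ) : ℂ) * I) :=
    (integrable_mul_sin hg y).ofReal.mul_const I
  rw [integral_add hi1 hi2, integral_mul_const, integral_complex_ofReal, integral_complex_ofReal]
    at hF
  have hR : ((π : ℂ) / (1 / 2)) ^ (1 / 2 : ℂ) * Complex.exp (-(y : ℂ) ^ 2 / (4 * (1 / 2))) =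
      ((Real.sqrt (2 * π) * Real.exp (-(1 / 2) * y ^ 2) : ℝ) : ℂ) := by
    have e1 : ((π : ℂ) / (1 / 2)) = ((2 * π : ℝ) : ℂ) := by push_cast; ring
    have e2 : (1 / 2 : ℂ) = ((1 / 2 : ℝ) : ℂ) := by push_cast; ring
    rw [e1, e2, ← Complex.ofReal_cpow (by positivity), Real.sqrt_eq_rpow]
    push_cast
    ring_nf
  rw [hR] at hF
  have hre := congrArg Complex.re hF
  simp only [Complex.add_re, Complex.ofReal_re, Complex.mul_re, Complex.I_re, Complex.I_im,
    Complex.ofReal_im, mul_zero, mul_one, sub_zero, add_zero] at hre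
  have heven : ∫ x : ℝ, Real.exp (-(1 / 2) * x ^ 2) * Real.cos (y * x) =
      ∫ x : ℝ, (fun v => Real.exp (-(1 / 2) * v ^ 2) * Real.cos (y * v)) |x| := by
    congr 1; ext x
    rcases le_or_gt 0 x with h | h
    · rw [abs_of_nonneg h]
    · simp only [abs_of_neg h, mul_neg, Real.cos_neg, neg_sq]
  have h2 : ∫ x : ℝ, Real.exp (-(1 / 2) * x ^ 2) * Real.cos (y * x) =
      2 * ∫ x in Ioi (0 : ℝ), Real.exp (-(1 / 2) * x ^ 2) * Real.cos (y * x) := by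
    rw [heven]
    exact integral_comp_abs (f := fun v => Real.exp (-(1 / 2) * v ^ 2) * Real.cos (y * v))
  rw [h2] at hre
  linarith

/-- The Dirichlet integral of the Gaussian: `∫₀^∞ e^{−u²/2} sin(Tu)/u du = (√(2π)/2) ∫₀^T e^{−y²/2} dy`
for `T ≥ 0`. [folklore] -/
theorem integral_Ioi_gaussian_mul_sin_div {T : ℝ} (hT : 0 ≤ T) :
    ∫ u in Ioi (0 : ℝ), Real.exp (-(1 / 2) * u ^ 2) * (Real.sin (T * u) / u) =
      Real.sqrt (2 * π) / 2 * ∫ y in (0 : ℝ)..T, Real.exp (-(1 / 2) * y ^ 2) := by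
  rw [← intervalIntegral_integral_Ioi_mul_cos (by fun_prop)
    (integrable_exp_neg_mul_sq one_half_pos).integrableOn hT]
  simp_rw [integral_Ioi_gaussian_mul_cos]
  rw [intervalIntegral.integral_const_mul]

/-- `∫₀^∞ e^{−u²/2} sin(Tu)/u du → π/2` as `T → +∞` (the value `∫₀^∞ sin u/u du = π/2`, realised with a
Gaussian weight). [folklore] -/
theorem tendsto_integral_Ioi_gaussian_mul_sin_div :
    Tendsto (fun T : ℝ => ∫ u in Ioi (0 : ℝ), Real.exp (-(1 / 2) * u ^ 2) * (Real.sin (T * u) / u))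
      atTop (𝓝 (π / 2)) := by
  have h1 : Tendsto (fun T : ℝ => ∫ y in (0 : ℝ)..T, Real.exp (-(1 / 2) * y ^ 2)) atTop
      (𝓝 (∫ y in Ioi (0 : ℝ), Real.exp (-(1 / 2) * y ^ 2))) :=
    intervalIntegral_tendsto_integral_Ioi 0 (integrable_exp_neg_mul_sq one_half_pos).integrableOn
      tendsto_id
  rw [integral_gaussian_Ioi (1 / 2)] at h1
  have h2 := h1.const_mul (Real.sqrt (2 * π) / 2)
  have hval : Real.sqrt (2 * π) / 2 * (Real.sqrt (π / (1 / 2)) / 2) = π / 2 := by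
    rw [show π / (1 / 2) = 2 * π by ring]
    have := Real.mul_self_sqrt (by positivity : 0 ≤ 2 * π)
    nlinarith [this]
  rw [hval] at h2
  refine h2.congr' ?_
  filter_upwards [eventually_ge_atTop 0] with T hT
  rw [integral_Ioi_gaussian_mul_sin_div hT]

/-! ## The remainder and the Dirichlet-integral limit -/

section Dirichlet

variable {φ : ℝ → ℝ}

/-- `1 − e^{−u²/2} ≤ u²/2`. [folklore] -/
theorem one_sub_exp_neg_half_sq_le (u : ℝ) : 1 - Real.exp (-(1 / 2) * u ^ 2) ≤ u ^ 2 / 2 := by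
  have := Real.add_one_le_exp (-(1 / 2) * u ^ 2)
  linarith

/-- The remainder `(φ(u) − φ(0)e^{−u²/2})/u` is bounded on `(0, 1]` when `|φ(u) − φ(0)| ≤ Cu` there.
[folklore] -/
theorem abs_dirichletRemainder_le {C : ℝ} (hC : ∀ u ∈ Ioc (0 : ℝ) 1, |φ u - φ 0| ≤ C * u)
    {u : ℝ} (hu : u ∈ Ioc (0 : ℝ) 1) :
    |(φ u - φ 0 * Real.exp (-(1 / 2) * u ^ 2)) / u| ≤ C + |φ 0| := by
  have hu0 := hu.1
  have hu1 := hu.2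
  rw [abs_div, abs_of_pos hu0, div_le_iff₀ hu0]
  have h1 := hC u hu
  have hg1 : Real.exp (-(1 / 2) * u ^ 2) ≤ 1 := by
    rw [Real.exp_le_one_iff]; nlinarith [sq_nonneg u]
  have h2 : |φ 0 * (1 - Real.exp (-(1 / 2) * u ^ 2))| ≤ |φ 0| * u := by
    rw [abs_mul, abs_of_nonneg (sub_nonneg.mpr hg1)]
    refine mul_le_mul_of_nonneg_left ?_ (abs_nonneg _)
    have := one_sub_exp_neg_half_sq_le u
    nlinarith
  calc |φ u - φ 0 * Real.exp (-(1 / 2) * u ^ 2)|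
        = |(φ u - φ 0) + φ 0 * (1 - Real.exp (-(1 / 2) * u ^ 2))| := by ring_nf
    _ ≤ |φ u - φ 0| + |φ 0 * (1 - Real.exp (-(1 / 2) * u ^ 2))| := abs_add_le _ _
    _ ≤ C * u + |φ 0| * u := add_le_add h1 h2
    _ = (C + |φ 0|) * u := by ring

/-- The remainder `(φ(u) − φ(0)e^{−u²/2})/u` is integrable on `(0, ∞)`. [folklore] -/
theorem integrableOn_dirichletRemainder (hφc : Continuous φ) (hφ : IntegrableOn φ (Ioi 0))
    (hL : ∃ C, ∀ u ∈ Ioc (0 : ℝ) 1, |φ u - φ 0| ≤ C * u) :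
    IntegrableOn (fun u => (φ u - φ 0 * Real.exp (-(1 / 2) * u ^ 2)) / u) (Ioi 0) := by
  have hmeas : Measurable fun u => (φ u - φ 0 * Real.exp (-(1 / 2) * u ^ 2)) / u :=
    (hφc.sub (continuous_const.mul (by fun_prop))).measurable.div measurable_id
  rw [← Ioc_union_Ioi_eq_Ioi zero_le_one]
  refine IntegrableOn.union ?_ ?_
  · obtain ⟨C, hC⟩ := hL
    refine Measure.integrableOn_of_bounded measure_Ioc_lt_top.ne hmeas.aestronglyMeasurable
      (M := C + |φ 0|) ?_
    rw [ae_restrict_iff' measurableSet_Ioc]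
    exact Eventually.of_forall fun u hu => by
      rw [Real.norm_eq_abs]; exact abs_dirichletRemainder_le hC hu
  · have hg : IntegrableOn (fun u => ‖φ u‖ + |φ 0| * Real.exp (-(1 / 2) * u ^ 2)) (Ioi 1) :=
      ((hφ.mono_set (Ioi_subset_Ioi zero_le_one)).norm).add
        ((integrable_exp_neg_mul_sq one_half_pos).integrableOn.const_mul _)
    refine Integrable.mono' hg hmeas.aestronglyMeasurable ?_
    rw [ae_restrict_iff' measurableSet_Ioi]
    refine Eventually.of_forall fun u hu => ?_
    have hu1 : (1 : ℝ) < u := hu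
    rw [Real.norm_eq_abs, abs_div, abs_of_pos (by linarith : (0 : ℝ) < u)]
    calc |φ u - φ 0 * Real.exp (-(1 / 2) * u ^ 2)| / u
          ≤ |φ u - φ 0 * Real.exp (-(1 / 2) * u ^ 2)| := div_le_self (abs_nonneg _) hu1.le
      _ ≤ |φ u| + |φ 0 * Real.exp (-(1 / 2) * u ^ 2)| := abs_sub _ _
      _ = ‖φ u‖ + |φ 0| * Real.exp (-(1 / 2) * u ^ 2) := by
          rw [abs_mul, abs_of_pos (Real.exp_pos _), Real.norm_eq_abs]

/-- Decomposition `∫₀^∞ φ(u) sin(Tu)/u = φ(0) ∫₀^∞ e^{−u²/2} sin(Tu)/u + ∫₀^∞ r(u) sin(Tu)`,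
`r = (φ − φ(0)e^{−u²/2})/u`. [folklore] -/
theorem integral_Ioi_mul_sin_div_eq (hφc : Continuous φ) (hφ : IntegrableOn φ (Ioi 0))
    (hL : ∃ C, ∀ u ∈ Ioc (0 : ℝ) 1, |φ u - φ 0| ≤ C * u) (T : ℝ) :
    ∫ u in Ioi (0 : ℝ), φ u * (Real.sin (T * u) / u) =
      φ 0 * (∫ u in Ioi (0 : ℝ), Real.exp (-(1 / 2) * u ^ 2) * (Real.sin (T * u) / u)) +
        ∫ u in Ioi (0 : ℝ), (φ u - φ 0 * Real.exp (-(1 / 2) * u ^ 2)) / u * Real.sin (T * u) := by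
  have hi1 : IntegrableOn (fun u => φ 0 * (Real.exp (-(1 / 2) * u ^ 2) * (Real.sin (T * u) / u)))
      (Ioi 0) :=
    (integrable_mul_sin_div (integrable_exp_neg_mul_sq one_half_pos).integrableOn T).const_mul _
  have hi2 := integrable_mul_sin (integrableOn_dirichletRemainder hφc hφ hL) T
  rw [← integral_const_mul, ← integral_add hi1 hi2]
  refine setIntegral_congr_fun measurableSet_Ioi fun u hu => ?_
  have hu' : u ≠ 0 := ne_of_gt hu
  field_simp
  ring

/-- **Dirichlet's integral** (Dirichlet 1829; Titchmarsh, *Fourier Integrals* §1.9): if `φ` is continuous,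
integrable on `(0, ∞)` and `|φ(u) − φ(0)| ≤ C u` on `(0, 1]`, then
`∫₀^∞ φ(u) sin(Tu)/u du → (π/2) φ(0)` as `T → +∞`. [folklore] -/
theorem tendsto_integral_Ioi_mul_sin_div (hφc : Continuous φ) (hφ : IntegrableOn φ (Ioi 0))
    (hL : ∃ C, ∀ u ∈ Ioc (0 : ℝ) 1, |φ u - φ 0| ≤ C * u) :
    Tendsto (fun T : ℝ => ∫ u in Ioi (0 : ℝ), φ u * (Real.sin (T * u) / u)) atTop
      (𝓝 (π / 2 * φ 0)) := by
  have h1 := (tendsto_integral_Ioi_gaussian_mul_sin_div.const_mul (φ 0)).add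
    (tendsto_integral_Ioi_mul_sin_atTop (integrableOn_dirichletRemainder hφc hφ hL))
  rw [add_zero, mul_comm] at h1
  exact h1.congr fun T => (integral_Ioi_mul_sin_div_eq hφc hφ hL T).symm

end Dirichlet

/-! ## `∫₀^∞ sin t / t dt = π/2` (append, 2026-08-26: the value itself, which the construction above
avoided, now follows from it) -/

section SineIntegralLimit

/-- The scaling `t = Tu`: `∫₀^T sin t / t dt = ∫₀¹ sin(Tu)/u du` (`T ≠ 0`). [cite: CourantMcshane1988, Vol. II Ch. IV Appendix §1 Example 1 «Dirichlet's discontinuous factor» at x = 0 (PDF p. 236); Titchmarsh1948, §1.9] -/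
theorem intervalIntegral_sin_div_eq_comp_mul {T : ℝ} (hT : T ≠ 0) :
    ∫ t in (0 : ℝ)..T, Real.sin t / t = ∫ u in (0 : ℝ)..1, Real.sin (T * u) / u := by
  have h := intervalIntegral.integral_comp_mul_left (fun t : ℝ => Real.sin t / t) hT (a := 0) (b := 1)
  rw [mul_zero, mul_one] at h
  have e2 : (fun u : ℝ => Real.sin (T * u) / u) = fun u => T * (Real.sin (T * u) / (T * u)) := by
    funext u
    rcases eq_or_ne u 0 with rfl | hu
    · simp
    · field_simp
  rw [e2, intervalIntegral.integral_const_mul, h, smul_eq_mul, ← mul_assoc, mul_inv_cancel₀ hT,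
    one_mul]

/-- The remainder `(𝟙_{u ≤ 1} − e^{−u²/2})/u` is integrable on `(0, ∞)`: bounded by `u/2 ≤ 1/2` on
`(0, 1]` and by the Gaussian on `(1, ∞)`. [cite: CourantMcshane1988, Vol. II Ch. IV Appendix §1 Example 1 «Dirichlet's discontinuous factor» at x = 0 (PDF p. 236); Titchmarsh1948, §1.9] -/
theorem integrableOn_indicator_sub_gaussian_div :
    IntegrableOn (fun u : ℝ =>
      ((Iic (1 : ℝ)).indicator (fun _ => (1 : ℝ)) u - Real.exp (-(1 / 2) * u ^ 2)) / u) (Ioi 0) := by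
  have hmeas : Measurable fun u : ℝ =>
      ((Iic (1 : ℝ)).indicator (fun _ => (1 : ℝ)) u - Real.exp (-(1 / 2) * u ^ 2)) / u :=
    ((measurable_const.indicator measurableSet_Iic).sub (by fun_prop)).div measurable_id
  rw [← Ioc_union_Ioi_eq_Ioi zero_le_one, integrableOn_union]
  constructor
  · refine Measure.integrableOn_of_bounded (M := 1 / 2) measure_Ioc_lt_top.ne
      hmeas.aestronglyMeasurable ?_
    rw [ae_restrict_iff' measurableSet_Ioc]
    refine Eventually.of_forall fun u hu => ?_
    have hu0 : 0 < u := hu.1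
    rw [indicator_of_mem (show u ∈ Iic (1 : ℝ) from hu.2), Real.norm_eq_abs, abs_div, abs_of_pos hu0,
      abs_of_nonneg (by
        have : Real.exp (-(1 / 2) * u ^ 2) ≤ 1 := Real.exp_le_one_iff.2 (by nlinarith [sq_nonneg u])
        linarith),
      div_le_iff₀ hu0]
    have h1 := one_sub_exp_neg_half_sq_le u
    nlinarith [hu.2, sq_nonneg u]
  · refine Integrable.mono' ((integrable_exp_neg_mul_sq one_half_pos).integrableOn)
      hmeas.aestronglyMeasurable ?_
    rw [ae_restrict_iff' measurableSet_Ioi]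
    refine Eventually.of_forall fun u hu => ?_
    have hu1 : 1 < u := hu
    have hu' : u ∉ Iic (1 : ℝ) := fun h => not_le.2 hu1 h
    rw [indicator_of_notMem hu', zero_sub, neg_div, norm_neg, Real.norm_eq_abs, abs_div,
      abs_of_pos (Real.exp_pos _), abs_of_pos (by linarith), div_le_iff₀ (by linarith)]
    have := Real.exp_pos (-(1 / 2) * u ^ 2)
    nlinarith

/-- **`∫₀^∞ sin t / t dt = π/2`** (Dirichlet): `∫₀^T sin t/t dt → π/2` as `T → +∞`.  After `t = Tu`
(`intervalIntegral_sin_div_eq_comp_mul`) the integral is `∫₀¹ sin(Tu)/u du`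
`= ∫₀^∞ e^{−u²/2} sin(Tu)/u du + ∫₀^∞ r(u) sin(Tu) du`, `r = (𝟙_{u≤1} − e^{−u²/2})/u` integrable, so the
Gaussian model `tendsto_integral_Ioi_gaussian_mul_sin_div` and the Riemann–Lebesgue lemma
`tendsto_integral_Ioi_mul_sin_atTop` give the limit.  (Titchmarsh §1.9; Zygmund II §1.) [cite: CourantMcshane1988, Vol. II Ch. IV Appendix §1 Example 1 «Dirichlet's discontinuous factor» at x = 0 (PDF p. 236); Titchmarsh1948, §1.9] -/
theorem tendsto_intervalIntegral_sin_div_atTop :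
    Tendsto (fun T : ℝ => ∫ t in (0 : ℝ)..T, Real.sin t / t) atTop (𝓝 (π / 2)) := by
  set h : ℝ → ℝ := fun u =>
    ((Iic (1 : ℝ)).indicator (fun _ => (1 : ℝ)) u - Real.exp (-(1 / 2) * u ^ 2)) / u with hh
  have hh_int : IntegrableOn h (Ioi 0) := integrableOn_indicator_sub_gaussian_div
  have key : ∀ T : ℝ, 0 < T → ∫ t in (0 : ℝ)..T, Real.sin t / t =
      (∫ u in Ioi (0 : ℝ), Real.exp (-(1 / 2) * u ^ 2) * (Real.sin (T * u) / u)) +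
        ∫ u in Ioi (0 : ℝ), h u * Real.sin (T * u) := by
    intro T hT
    rw [intervalIntegral_sin_div_eq_comp_mul hT.ne', intervalIntegral.integral_of_le zero_le_one,
      ← integral_add (integrable_mul_sin_div (integrable_exp_neg_mul_sq one_half_pos).integrableOn T)
        (integrable_mul_sin hh_int T)]
    have e1 : ∫ u in Ioc (0 : ℝ) 1, Real.sin (T * u) / u =
        ∫ u in Ioi (0 : ℝ), (Iic (1 : ℝ)).indicator (fun u => Real.sin (T * u) / u) u := by
      rw [setIntegral_indicator measurableSet_Iic, Ioi_inter_Iic]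
    rw [e1]
    refine setIntegral_congr_fun measurableSet_Ioi fun u hu => ?_
    have hu0 : u ≠ 0 := ne_of_gt hu
    simp only [hh]
    by_cases hu1 : u ≤ 1
    · rw [indicator_of_mem (show u ∈ Iic (1 : ℝ) from hu1), indicator_of_mem (show u ∈ Iic (1 : ℝ) from hu1)]
      field_simp
      ring
    · rw [indicator_of_notMem (show u ∉ Iic (1 : ℝ) from hu1),
        indicator_of_notMem (show u ∉ Iic (1 : ℝ) from hu1)]
      field_simp
      ring
  have hlim := tendsto_integral_Ioi_gaussian_mul_sin_div.add (tendsto_integral_Ioi_mul_sin_atTop hh_int)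
  rw [add_zero] at hlim
  refine hlim.congr' ?_
  filter_upwards [eventually_gt_atTop 0] with T hT
  exact (key T hT).symm

/-- The odd reflection: `∫₀^T sin t/t dt → −π/2` as `T → −∞`. [cite: CourantMcshane1988, Vol. II Ch. IV Appendix §1 Example 1 «Dirichlet's discontinuous factor» at x = 0 (PDF p. 236); Titchmarsh1948, §1.9] -/
theorem tendsto_intervalIntegral_sin_div_atBot :
    Tendsto (fun T : ℝ => ∫ t in (0 : ℝ)..T, Real.sin t / t) atBot (𝓝 (-(π / 2))) := by
  have hodd : ∀ T : ℝ, ∫ t in (0 : ℝ)..(-T), Real.sin t / t = -∫ t in (0 : ℝ)..T, Real.sin t / t := by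
    intro T
    have heven : (fun t : ℝ => Real.sin t / t) = fun t => (fun u : ℝ => Real.sin u / u) (-t) := by
      funext t
      simp [Real.sin_neg, neg_div_neg_eq]
    conv_lhs => rw [heven]
    rw [intervalIntegral.integral_comp_neg (fun u : ℝ => Real.sin u / u), neg_neg, neg_zero,
      intervalIntegral.integral_symm]
  have h1 := (tendsto_intervalIntegral_sin_div_atTop.comp tendsto_neg_atBot_atTop).neg
  refine h1.congr fun T => ?_
  simp only [Function.comp_def]
  rw [hodd, neg_neg]

/-- `|∫₀^T sin t/t dt|` is bounded, uniformly in `T` (a bound `2` would do; here the soft form). [cite: CourantMcshane1988, Vol. II Ch. IV Appendix §1 Example 1 «Dirichlet's discontinuous factor» at x = 0 (PDF p. 236); Titchmarsh1948, §1.9] -/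
theorem exists_forall_abs_intervalIntegral_sin_div_le :
    ∃ C : ℝ, ∀ T : ℝ, |∫ t in (0 : ℝ)..T, Real.sin t / t| ≤ C := by
  -- `|∫₀^T| ≤ |T|` for all `T`, and the limits at `±∞` give boundedness outside a compact interval
  have hsmall : ∀ T : ℝ, |∫ t in (0 : ℝ)..T, Real.sin t / t| ≤ |T| := by
    intro T
    have h := intervalIntegral.norm_integral_le_of_norm_le_const (a := (0 : ℝ)) (b := T) (C := 1)
      (f := fun t : ℝ => Real.sin t / t) (fun t _ => ?_)
    · simpa using h
    · rw [Real.norm_eq_abs, abs_div]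
      rcases eq_or_ne t 0 with rfl | ht
      · simp
      · rw [div_le_one (abs_pos.2 ht)]
        exact Real.abs_sin_le_abs
  obtain ⟨R₁, hR₁⟩ := (tendsto_intervalIntegral_sin_div_atTop.eventually
    (Metric.ball_mem_nhds _ one_pos)).exists_forall_of_atTop
  obtain ⟨R₂, hR₂⟩ := (tendsto_intervalIntegral_sin_div_atBot.eventually
    (Metric.ball_mem_nhds _ one_pos)).exists_forall_of_atBot
  refine ⟨max (π / 2 + 1) (max |R₁| |R₂|), fun T => ?_⟩
  rcases le_or_gt R₁ T with h | h
  · have := hR₁ T h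
    rw [Real.dist_eq] at this
    have : |∫ t in (0 : ℝ)..T, Real.sin t / t| ≤ π / 2 + 1 := by
      have := abs_sub_abs_le_abs_sub (∫ t in (0 : ℝ)..T, Real.sin t / t) (π / 2)
      rw [abs_of_pos (by positivity : (0 : ℝ) < π / 2)] at this
      linarith
    exact this.trans (le_max_left _ _)
  rcases le_or_gt T R₂ with h' | h'
  · have := hR₂ T h'
    rw [Real.dist_eq] at this
    have : |∫ t in (0 : ℝ)..T, Real.sin t / t| ≤ π / 2 + 1 := by
      have := abs_sub_abs_le_abs_sub (∫ t in (0 : ℝ)..T, Real.sin t / t) (-(π / 2))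
      rw [abs_neg, abs_of_pos (by positivity : (0 : ℝ) < π / 2)] at this
      linarith
    exact this.trans (le_max_left _ _)
  · -- `R₂ < T < R₁`: use `|∫| ≤ |T| ≤ max |R₁| |R₂|`
    refine (hsmall T).trans (le_trans ?_ (le_max_right _ _))
    rcases le_or_gt 0 T with hT | hT
    · rw [abs_of_nonneg hT]; exact le_trans h.le ((le_abs_self R₁).trans (le_max_left _ _))
    · rw [abs_of_neg hT]
      exact le_trans (by linarith [neg_le_abs R₂, h'.le] : -T ≤ |R₂|) (le_max_right _ _)

end SineIntegralLimit

end Literature.Analysis.Fourier
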